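import Summits.BirchSwinnertonDyer.Rank1Residual.Partition.EisensteinKernelAbscissa
import HarnessLib

/-!
# Ramification at `3` of a rational `3`-line = non-integrality of its abscissa
# (integral models with `3 ∤ b₂`: `den(x₀) ∣ 3`, and `3 ∣ D ↔ x₀ ∉ ℤ`)

HONEST FRAMING (cell `b2b-bsdres-*`, verbatim): the goal of the cell is to DELETE the
COMBINATION-SHAPED residual classes for ALL analytic-rank ≤ 1 curves over ℚ — "full BSD formula
for every rank ≤ 1 curve in class C" assembled STRICTLY from published theorems — so that the
rank-≤1 remainder becomes exactly the CONSTRUCTION-SHAPED classes, which are TYPED (missing-input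
Props), NOT attempted; this is not "finishing BSD". Off-peak literature typer `b2b-bsdres-lit-cgls`
(CGLS22 / GV00, the reducible = Eisenstein column), session 13, file 6 of the `EisensteinKernel*`
series (sequel of `EisensteinKernelAbscissa`). Theorems only — no definition, no named fact, nothing
booked, no label changed; research-route bookkeeping, no claim about BSD is made here.

For an INTEGRAL model (`E₀ : WeierstrassCurve ℤ` with `E₀.map ℤ→ℚ = W`; e.g. `integralModelInt W` of
a globally minimal `W`, or an explicit `⟨a₁,…,a₆⟩` with integer entries) and the kernel-discriminant
certificate `(x₀, D, s)` of sessions 11–12 (`Ψ₃(x₀) = 0`, `D` squarefree, `D·s² = Ψ₂Sq(x₀)`):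

* §15a the RATIONAL-ROOT THEOREM for `Ψ₃ = 3X⁴ + b₂X³ + 3b₄X² + 3b₆X + b₈`: `den(x₀) ∣ 3`
  (`den_dvd_three_of_eval_Ψ₃`, `den_eq_one_or_eq_three_of_eval_Ψ₃`) — a rational root is an INTEGER or
  a THIRD `n/3`, `3 ∤ n`;
* §15b RAMIFIED ⇐ NON-INTEGRAL: `den(x₀) = 3 ⇒ 3 ∣ D` (`three_dvd_kernelDisc_of_den_eq_three`:
  `27·Ψ₂Sq(n/3) = 4n³ + 3b₂n² + 18b₄n + 27b₆ ≡ n³ ≢ 0 (mod 3)`, so `ord₃(D·s²) = −3` is odd — NO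
  hypothesis on the reduction, `x₀` need not even be a root of `Ψ₃`);
* §15c UNRAMIFIED ⇐ INTEGRAL: `den(x₀) = 1 ∧ 3 ∤ b₂ ⇒ 3 ∤ D` (`not_three_dvd_kernelDisc_of_den_eq_one`:
  `3 ∤ b₂` gives `c₄ ≡ b₂² ≢ 0`, so `D·t² = b₂ + 12x₀` (file 5, §14) is an integer `≢ 0 (mod 3)` and
  `ord₃ D` is even, i.e. `0` for squarefree `D`); together `3 ∣ D ↔ den(x₀) ≠ 1`
  (`three_dvd_kernelDisc_iff_den_ne_one`);
* §15d line level: **`lineUnramifiedAt_three_iff_den_eq_one` — a rational `3`-line of an integral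
  model with `3 ∤ b₂` is UNRAMIFIED at `3` iff the abscissa of its (non-zero) points is an INTEGER**
  (session 11's `lineUnramifiedAt_iff_not_dvd : LineUnramifiedAt ↔ ¬ 3 ∣ D` + §15b–c).

For a globally minimal model `3 ∤ b₂` IS "good ordinary or multiplicative reduction at `3`"
(`c₄ ≡ b₂² (mod 3)`; file 7 `EisensteinKernelAbscissaType`: `not_three_dvd_b₂_of_goodOrd`,
`not_three_dvd_b₂_of_mult`). CONSUMER (EVIDENCE join, nothing booked): cc-eng-1's engine E3L observed
"`3 ∣ D ⟺ x₀ ∉ ℤ`" on all 49 144 rational `3`-lines of the 48 216 curves of the 21 106 KDISC3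
classes (`HOME/class-closure/eng-1/KDISC3-CLASSLINES-cceng1.md`) — §15 makes it a theorem on every
integral model with `3 ∤ b₂`.

References: J. H. Silverman, *The Arithmetic of Elliptic Curves*, GTM 106 (2009), III.1, Exercise
3.7 [SilvermanAEC2009]; HOME/b2b-bsdres-lit-cgls/CGLS-GV-TYPING.md §20.
-/

set_option autoImplicit false

noncomputable section

open scoped Classical NumberField

open WeierstrassCurve Polynomial Literature.NumberTheory.EllipticCurves
  Literature.NumberTheory.EllipticCurves.Rank1Residual Field IsDedekindDomain

namespace Summit.BirchSwinnertonDyer.Rank1Residual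

namespace KernelDisc

variable {W : WeierstrassCurve ℚ}

/-! ### §15. Integral models: `den(x₀) ∣ 3`; ramification at `3` = non-integrality of the abscissa -/

section Integral

variable (E₀ : WeierstrassCurve ℤ) (hE : E₀.map (Int.castRingHom ℚ) = W)

include hE in
/-- `b₂, b₄, b₆, b₈, c₄` of `W` are the casts of those of its integer model. [folklore] -/
theorem b_cast_of_map_eq :
    W.b₂ = (E₀.b₂ : ℚ) ∧ W.b₄ = (E₀.b₄ : ℚ) ∧ W.b₆ = (E₀.b₆ : ℚ) ∧ W.b₈ = (E₀.b₈ : ℚ) ∧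
      W.c₄ = (E₀.c₄ : ℚ) := by
  refine ⟨?_, ?_, ?_, ?_, ?_⟩
  · rw [← hE, map_b₂, eq_intCast]
  · rw [← hE, map_b₄, eq_intCast]
  · rw [← hE, map_b₆, eq_intCast]
  · rw [← hE, map_b₈, eq_intCast]
  · rw [← hE, map_c₄, eq_intCast]

include hE in
/-- **Rational-root theorem for `Ψ₃`: the denominator of a rational root divides the leading
coefficient `3`** (integer model `E₀` of `W`). Hence a rational root of `Ψ₃` is an integer or a third
`n/3` with `3 ∤ n`. [folklore] -/
theorem den_dvd_three_of_eval_Ψ₃ {x₀ : ℚ} (hψ : W.Ψ₃.eval x₀ = 0) : x₀.den ∣ 3 := by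
  obtain ⟨hb₂, hb₄, hb₆, hb₈, -⟩ := b_cast_of_map_eq E₀ hE
  have hψ' : 3 * x₀ ^ 4 + W.b₂ * x₀ ^ 3 + 3 * W.b₄ * x₀ ^ 2 + 3 * W.b₆ * x₀ + W.b₈ = 0 := by
    simpa only [WeierstrassCurve.Ψ₃, eval_add, eval_mul, eval_pow, eval_C, eval_X, eval_ofNat] using hψ
  rw [hb₂, hb₄, hb₆, hb₈] at hψ'
  set n : ℤ := x₀.num with hn
  set d : ℕ := x₀.den with hd
  have hnd : (n : ℚ) = x₀ * d := (Rat.mul_den_eq_num x₀).symm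
  have hZ : 3 * n ^ 4 + E₀.b₂ * n ^ 3 * d + 3 * E₀.b₄ * n ^ 2 * d ^ 2 + 3 * E₀.b₆ * n * d ^ 3 +
      E₀.b₈ * d ^ 4 = 0 := by
    have hQ : (3 * (n : ℚ) ^ 4 + (E₀.b₂ : ℚ) * n ^ 3 * d + 3 * (E₀.b₄ : ℚ) * n ^ 2 * (d : ℚ) ^ 2 +
        3 * (E₀.b₆ : ℚ) * n * (d : ℚ) ^ 3 + (E₀.b₈ : ℚ) * (d : ℚ) ^ 4) = 0 := by
      rw [hnd]
      linear_combination ((d : ℚ)) ^ 4 * hψ'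
    exact_mod_cast hQ
  have hdvd : (d : ℤ) ∣ 3 * n ^ 4 :=
    ⟨-(E₀.b₂ * n ^ 3 + 3 * E₀.b₄ * n ^ 2 * d + 3 * E₀.b₆ * n * d ^ 2 + E₀.b₈ * d ^ 3), by
      linear_combination hZ⟩
  have hcop : IsCoprime (d : ℤ) n := by
    rw [Int.isCoprime_iff_gcd_eq_one, Int.gcd_comm]
    have := x₀.reduced
    simpa [Int.gcd, hn, hd] using this
  have h3 : (d : ℤ) ∣ 3 := (hcop.pow_right (n := 4)).dvd_of_dvd_mul_right hdvd
  exact_mod_cast h3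

include hE in
/-- The dichotomy: a rational root of `Ψ₃` of an integral model has denominator `1` or `3`.
[folklore] -/
theorem den_eq_one_or_eq_three_of_eval_Ψ₃ {x₀ : ℚ} (hψ : W.Ψ₃.eval x₀ = 0) :
    x₀.den = 1 ∨ x₀.den = 3 :=
  (Nat.dvd_prime Nat.prime_three).mp (den_dvd_three_of_eval_Ψ₃ E₀ hE hψ)

include hE in
/-- **RAMIFIED ⇐ NON-INTEGRAL: `den(x₀) = 3 ⇒ 3 ∣ D`** for any certificate `D·s² = Ψ₂Sq(x₀)` of an
integral model (no hypothesis on the reduction, `x₀` need not even be a root of `Ψ₃`): with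
`x₀ = n/3`, `3 ∤ n`, `27·Ψ₂Sq(x₀) = 4n³ + 3b₂n² + 18b₄n + 27b₆ ≡ n³ ≢ 0 (mod 3)`, so
`ord₃(D·s²) = −3` is odd and `ord₃ D ≠ 0`. [folklore] -/
theorem three_dvd_kernelDisc_of_den_eq_three {x₀ s : ℚ} {D : ℤ} (hD0 : D ≠ 0) (hs : s ≠ 0)
    (hDs : (D : ℚ) * s ^ 2 = W.Ψ₂Sq.eval x₀) (hden : x₀.den = 3) : (3 : ℤ) ∣ D := by
  haveI : Fact (Nat.Prime 3) := ⟨Nat.prime_three⟩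
  obtain ⟨hb₂, hb₄, hb₆, -, -⟩ := b_cast_of_map_eq E₀ hE
  set n : ℤ := x₀.num with hn
  have hx : x₀ = (n : ℚ) / 3 := by
    conv_lhs => rw [← Rat.num_div_den x₀, hden]
    norm_cast
  -- `3 ∤ n`
  have h3n : ¬ (3 : ℤ) ∣ n := by
    intro h3
    have hc : Nat.Coprime n.natAbs 3 := by simpa [hden] using x₀.reduced
    have h3' : 3 ∣ n.natAbs := Int.ofNat_dvd_left.mp h3
    have := Nat.dvd_gcd h3' (dvd_refl 3)
    rw [hc] at this
    exact absurd this (by norm_num)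
  -- the numerator
  set N₁ : ℤ := 4 * n ^ 3 + 3 * E₀.b₂ * n ^ 2 + 18 * E₀.b₄ * n + 27 * E₀.b₆ with hN₁
  have hF : W.Ψ₂Sq.eval x₀ = (N₁ : ℚ) / 27 := by
    rw [eval_Ψ₂Sq, hb₂, hb₄, hb₆, hx, hN₁]
    push_cast
    ring
  have h3N : ¬ (3 : ℤ) ∣ N₁ := by
    intro h3
    have h4 : (3 : ℤ) ∣ 4 * n ^ 3 := by
      have : N₁ = 3 * (E₀.b₂ * n ^ 2 + 6 * E₀.b₄ * n + 9 * E₀.b₆) + 4 * n ^ 3 := by rw [hN₁]; ring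
      rw [this] at h3
      exact (dvd_add_right (dvd_mul_right 3 _)).mp h3
    rcases Int.prime_three.dvd_or_dvd h4 with h | h
    · exact absurd h (by norm_num)
    · exact h3n (Int.prime_three.dvd_of_dvd_pow h)
  have hN0' : N₁ ≠ 0 := fun h ↦ h3N (by rw [h]; exact dvd_zero 3)
  have hN0 : (N₁ : ℚ) ≠ 0 := Int.cast_ne_zero.mpr hN0'
  -- valuations: `ord₃ D + 2·ord₃ s = ord₃ N₁ − 3 = −3`
  have hv := congrArg (padicValRat 3) (hDs.trans hF)
  have h27 : padicValRat 3 (27 : ℚ) = 3 := by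
    rw [show (27 : ℚ) = ((3 : ℕ) : ℚ) ^ 3 by norm_num, padicValRat.pow, padicValRat.self (by norm_num)]
    norm_num
  rw [padicValRat.mul (Int.cast_ne_zero.mpr hD0) (pow_ne_zero 2 hs), padicValRat.pow,
    padicValRat.div hN0 (by norm_num), h27, padicValRat.of_int, padicValRat.of_int,
    padicValInt.eq_zero_of_not_dvd h3N] at hv
  by_contra h3D
  rw [padicValInt.eq_zero_of_not_dvd h3D] at hv
  push_cast at hv
  omega

include hE in
/-- **UNRAMIFIED ⇐ INTEGRAL: `den(x₀) = 1 ∧ 3 ∤ b₂ ⇒ 3 ∤ D`** for a SQUAREFREE certificate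
`D·s² = Ψ₂Sq(x₀)` at a root `x₀` of `Ψ₃` of an integral model of an elliptic curve: `3 ∤ b₂` gives
`3 ∤ c₄` (`c₄ ≡ b₂² (mod 3)`), so `D·t² = b₂ + 12x₀` (§14) is an integer `≢ 0 (mod 3)`, whence
`ord₃ D` is even, i.e. `0`. [folklore] -/
theorem not_three_dvd_kernelDisc_of_den_eq_one [W.IsElliptic] {x₀ s : ℚ} {D : ℤ}
    (hψ : W.Ψ₃.eval x₀ = 0) (hsq : Squarefree D) (hs : s ≠ 0)
    (hDs : (D : ℚ) * s ^ 2 = W.Ψ₂Sq.eval x₀) (hb : ¬ (3 : ℤ) ∣ E₀.b₂) (hden : x₀.den = 1) :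
    ¬ (3 : ℤ) ∣ D := by
  haveI : Fact (Nat.Prime 3) := ⟨Nat.prime_three⟩
  obtain ⟨hb₂, -, -, -, hc₄⟩ := b_cast_of_map_eq E₀ hE
  -- `c₄ ≠ 0`
  have hc₄0 : W.c₄ ≠ 0 := by
    rw [hc₄]
    have h : E₀.c₄ ≠ 0 := by
      intro h0
      apply hb
      have h3 : (3 : ℤ) ∣ E₀.b₂ ^ 2 := ⟨8 * E₀.b₄, by
        have : E₀.b₂ ^ 2 - 24 * E₀.b₄ = 0 := by simpa [WeierstrassCurve.c₄] using h0
        linear_combination this⟩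
      exact Int.prime_three.dvd_of_dvd_pow h3
    exact_mod_cast h
  obtain ⟨t, ht, hDt⟩ :=
    exists_mul_sq_eq_b₂_add hψ (b₂_add_ne_zero_of_eval_Ψ₃ hψ hc₄0) hsq.ne_zero hs hDs
  set n : ℤ := x₀.num with hn
  have hx : x₀ = (n : ℚ) := (Rat.coe_int_num_of_den_eq_one hden).symm
  set M : ℤ := E₀.b₂ + 12 * n with hM
  have hDM : (D : ℚ) * t ^ 2 = (M : ℚ) := by
    rw [hDt, hb₂, hx, hM]
    push_cast
    ring
  have h3M : ¬ (3 : ℤ) ∣ M := by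
    intro h3
    apply hb
    have : E₀.b₂ = M - 3 * (4 * n) := by rw [hM]; ring
    rw [this]
    exact dvd_sub h3 (dvd_mul_right 3 _)
  have hM0' : M ≠ 0 := fun h ↦ h3M (by rw [h]; exact dvd_zero 3)
  have hM0 : (M : ℚ) ≠ 0 := Int.cast_ne_zero.mpr hM0'
  have hv := congrArg (padicValRat 3) hDM
  rw [padicValRat.mul (Int.cast_ne_zero.mpr hsq.ne_zero) (pow_ne_zero 2 ht), padicValRat.pow,
    padicValRat.of_int, padicValRat.of_int, padicValInt.eq_zero_of_not_dvd h3M] at hv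
  -- the divisibility/valuation dictionary at `3`, casts normalised
  have hdvd : ∀ k : ℕ, (3 : ℤ) ^ k ∣ D ↔ D = 0 ∨ k ≤ padicValInt 3 D := fun k ↦ by
    have := padicValInt_dvd_iff (p := 3) k D
    push_cast at this
    exact this
  -- `D` squarefree: `ord₃ D ≤ 1`
  have hle : padicValInt 3 D ≤ 1 := by
    rcases le_or_gt (padicValInt 3 D) 1 with hle | hlt
    · exact hle
    · have h9 : (3 : ℤ) ^ 2 ∣ D := (hdvd 2).mpr (Or.inr hlt)
      have hu : IsUnit (3 : ℤ) := hsq 3 (by simpa [pow_two] using h9)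
      rcases Int.isUnit_iff.mp hu with h1 | h1 <;> norm_num at h1
  intro h3D
  have hge : 1 ≤ padicValInt 3 D :=
    (((hdvd 1).mp (by simpa using h3D)).resolve_left hsq.ne_zero)
  push_cast at hv
  omega

include hE in
/-- **`3 ∣ D ↔ den(x₀) ≠ 1`** (equivalently `↔ den(x₀) = 3`, `↔ x₀ ∉ ℤ`) for a squarefree
certificate `(x₀, D, s)` of an integral model of an elliptic curve with `3 ∤ b₂`. [folklore] -/
theorem three_dvd_kernelDisc_iff_den_ne_one [W.IsElliptic] {x₀ s : ℚ} {D : ℤ}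
    (hψ : W.Ψ₃.eval x₀ = 0) (hsq : Squarefree D) (hs : s ≠ 0)
    (hDs : (D : ℚ) * s ^ 2 = W.Ψ₂Sq.eval x₀) (hb : ¬ (3 : ℤ) ∣ E₀.b₂) :
    (3 : ℤ) ∣ D ↔ x₀.den ≠ 1 := by
  rcases den_eq_one_or_eq_three_of_eval_Ψ₃ E₀ hE hψ with h1 | h3
  · exact ⟨fun h ↦ absurd h (not_three_dvd_kernelDisc_of_den_eq_one E₀ hE hψ hsq hs hDs hb h1),
      fun h ↦ absurd h1 h⟩
  · exact ⟨fun _ ↦ by rw [h3]; decide,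
      fun _ ↦ three_dvd_kernelDisc_of_den_eq_three E₀ hE hsq.ne_zero hs hDs h3⟩

include hE in
/-- **A rational `3`-line of an integral model with `3 ∤ b₂` is UNRAMIFIED at `3` iff the abscissa
of its (non-zero) points is an INTEGER** (`LineUnramifiedAt W 3 Φ ↔ den(x₀) = 1`; session 11's
`lineUnramifiedAt_iff_not_dvd` + §15). For a globally minimal model `3 ∤ b₂` is "good ordinary or
multiplicative reduction at `3`" (`not_three_dvd_b₂_of_goodOrd`, `not_three_dvd_b₂_of_mult`).
[folklore] -/
theorem lineUnramifiedAt_three_iff_den_eq_one [W.IsElliptic] (hb : ¬ (3 : ℤ) ∣ E₀.b₂)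
    {Φ : AddSubgroup (geomTorsion W ((3 : ℕ) : ℤ))} (hΦ : IsRationalLine W 3 Φ)
    {P : geomTorsion W ((3 : ℕ) : ℤ)} (hP : P ∈ Φ) (hP0 : P ≠ 0) {x₀ : ℚ} {y : AlgebraicClosure ℚ}
    {h : (W.baseChange (AlgebraicClosure ℚ)).toAffine.Nonsingular (algebraMap ℚ (AlgebraicClosure ℚ) x₀) y}
    (hPe : (P : W.geomPoints) = Affine.Point.some (algebraMap ℚ (AlgebraicClosure ℚ) x₀) y h) :
    LineUnramifiedAt W 3 Φ ↔ x₀.den = 1 := by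
  have h32 : (3 : ℕ) ≠ 2 := by decide
  have hq := isQuadratic_three hΦ
  obtain ⟨x₁, y₁, h₁, hPe₁, hF0, hχ₁⟩ := exists_disc_of_mem hΦ h32 hq hP hP0
  have hx : x₁ = x₀ := by
    have e := hPe₁.symm.trans hPe
    injection e with ex _
    exact (algebraMap ℚ (AlgebraicClosure ℚ)).injective ex
  subst hx
  have hψ : W.Ψ₃.eval x₁ = 0 := eval_Ψ₃_eq_zero_of_mem hΦ hP hP0 hPe
  obtain ⟨D, s, hsq, hD0, hs, hDs⟩ :=
    exists_squarefree_mul_sq (4 * x₁ ^ 3 + W.b₂ * x₁ ^ 2 + 2 * W.b₄ * x₁ + W.b₆) hF0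
  have hχ : ∀ σ : absoluteGaloisGroup ℚ,
      (∀ Q ∈ Φ, σ • Q = Q) ↔ σ • geomSqrt (D : ℚ) = geomSqrt (D : ℚ) := fun σ ↦ by
    rw [forall_smul_eq_iff_of_mem hΦ hP hP0 σ, hχ₁ σ]
    exact smul_geomSqrt_iff_of_eq_mul_sq (Int.cast_ne_zero.mpr hD0) hs hDs σ
  have hDs' : (D : ℚ) * s ^ 2 = W.Ψ₂Sq.eval x₁ := by rw [eval_Ψ₂Sq, hDs]
  rw [lineUnramifiedAt_iff_not_dvd h32 hD0 hχ hsq, Nat.cast_ofNat,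
    three_dvd_kernelDisc_iff_den_ne_one E₀ hE hψ hsq hs hDs' hb, not_not]

end Integral

end KernelDisc

end Summit.BirchSwinnertonDyer.Rank1Residual

end
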